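import Summits.NavierStokesRegularity.NavierStokesRegularity.Theorems.RellichScarScarRigidityVorticityDefect
import HarnessLib

/-!
# `ScarRigidity`, line `moment-conditioned-rellich` — stub `stub_biotSavartFarField` (BS), part 2:
# apex weights at scale `a`, and densities with vanishing moments of order `≤ 2`

Crux stmt-NavierStokesRegularity-11717 (route RellichScar), helper file (`--supports`) for the registered stub
`stub_biotSavartFarField` (skeleton `Cruxes/ScarRigidity/Lines/moment_conditioned_rellich.lean`).

For a continuous density `F : ℝ³ → ℝ³` with the septic apex bound `‖F(y)‖ ≤ N a⁴/(‖y‖+a)⁷` (`a > 0`):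

* `integral_norm_pow_mul_inv_norm_add_pow` — the scaling `∫ ‖y‖ᵈ/(‖y‖+a)ᵖ dy = a^{3+d}/aᵖ ∫ ‖z‖ᵈ/(‖z‖+1)ᵖ dz`;
* integrability of `F`, `y_l F`, `y_l y_n F`, `‖y‖³‖F‖`, with **`∫ ‖y‖³ ‖F(y)‖ dy ≤ N I a³`**, `I = ∫ ‖z‖³/(‖z‖+1)⁷`
  (`integral_norm_cube_mul_norm_le`);
* if the first / second coordinate moments of `F` vanish, then so do the moments against every continuous
  `1`- / `2`-multilinear form: `∫ M(y, …, y) • F(y) dy = 0` (`integral_multilinear_one_smul_eq_zero`,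
  `integral_multilinear_two_smul_eq_zero`; expansion in the standard basis).
-/

noncomputable section

open Set Filter Function MeasureTheory Metric TopologicalSpace
open scoped Topology

set_option linter.dupNamespace false -- D-0017: `Summit.<S>.<S>.…` repeats the summit name by design

namespace Summit.NavierStokesRegularity.NavierStokesRegularity.Theorems.RellichScarScarRigidity

open Literature.Analysis.FluidPDE

/-! ### Apex weights at scale `a` -/

/-- **Scaling**: `∫ ‖y‖ᵈ (‖y‖+a)⁻ᵖ dy = a^{3+d}/aᵖ ∫ ‖z‖ᵈ (‖z‖+1)⁻ᵖ dz` on `ℝ³` (`y = a z`). [folklore] -/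
theorem integral_norm_pow_mul_inv_norm_add_pow {a : ℝ} (ha : 0 < a) (d p : ℕ) :
    ∫ y : EuclideanSpace ℝ (Fin 3), ‖y‖ ^ d * ((‖y‖ + a) ^ p)⁻¹ =
      a ^ (3 + d) / a ^ p * ∫ y : EuclideanSpace ℝ (Fin 3), ‖y‖ ^ d * ((‖y‖ + 1) ^ p)⁻¹ := by
  have h := Measure.integral_comp_inv_smul_of_nonneg volume
    (fun y : EuclideanSpace ℝ (Fin 3) => ‖y‖ ^ d * ((‖y‖ + 1) ^ p)⁻¹) ha.le
  rw [finrank_euclideanSpace, Fintype.card_fin, smul_eq_mul] at h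
  have e : ∀ y : EuclideanSpace ℝ (Fin 3), ‖a⁻¹ • y‖ ^ d * ((‖a⁻¹ • y‖ + 1) ^ p)⁻¹ =
      a ^ p / a ^ d * (‖y‖ ^ d * ((‖y‖ + a) ^ p)⁻¹) := fun y => by
    have hρ : ‖y‖ + a ≠ 0 := by positivity
    have ha' : a ≠ 0 := ha.ne'
    rw [norm_smul, norm_inv, Real.norm_of_nonneg ha.le,
      show a⁻¹ * ‖y‖ + 1 = a⁻¹ * (‖y‖ + a) by field_simp, mul_pow, mul_pow, inv_pow, inv_pow]
    field_simp
  simp_rw [e] at h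
  rw [integral_const_mul] at h
  have hp : (0 : ℝ) < a ^ p / a ^ d := by positivity
  rw [div_mul_eq_mul_div, eq_div_iff (pow_pos ha p).ne']
  calc (∫ y : EuclideanSpace ℝ (Fin 3), ‖y‖ ^ d * ((‖y‖ + a) ^ p)⁻¹) * a ^ p
      = a ^ d * (a ^ p / a ^ d * ∫ y : EuclideanSpace ℝ (Fin 3), ‖y‖ ^ d * ((‖y‖ + a) ^ p)⁻¹) := by
        field_simp
    _ = a ^ (3 + d) * ∫ y : EuclideanSpace ℝ (Fin 3), ‖y‖ ^ d * ((‖y‖ + 1) ^ p)⁻¹ := by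
        rw [h]; ring

/-- `‖y‖ᵈ (‖y‖+a)^{-(d+q)} ≤ (‖y‖+a)^{-q}` for `a > 0`. [folklore] -/
theorem norm_pow_mul_inv_norm_add_pow_le {a : ℝ} (ha : 0 < a) (d q : ℕ) (y : EuclideanSpace ℝ (Fin 3)) :
    ‖y‖ ^ d * ((‖y‖ + a) ^ (d + q))⁻¹ ≤ ((‖y‖ + a) ^ q)⁻¹ := by
  have hρ : 0 < ‖y‖ + a := by positivity
  have h1 : ‖y‖ ^ d ≤ (‖y‖ + a) ^ d := pow_le_pow_left₀ (norm_nonneg _) (by linarith) d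
  rw [pow_add, mul_inv, ← mul_assoc]
  calc ‖y‖ ^ d * ((‖y‖ + a) ^ d)⁻¹ * ((‖y‖ + a) ^ q)⁻¹ ≤ 1 * ((‖y‖ + a) ^ q)⁻¹ := by
        refine mul_le_mul_of_nonneg_right ?_ (by positivity)
        rw [mul_inv_le_iff₀ (pow_pos hρ d), one_mul]
        exact h1
    _ = ((‖y‖ + a) ^ q)⁻¹ := one_mul _

/-- **`y ↦ ‖y‖ᵈ (‖y‖+a)^{-(d+4)}` is integrable on `ℝ³`** (`a > 0`). [folklore] -/
theorem integrable_norm_pow_mul_inv_norm_add_pow {a : ℝ} (ha : 0 < a) (d : ℕ) :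
    Integrable (fun y : EuclideanSpace ℝ (Fin 3) => ‖y‖ ^ d * ((‖y‖ + a) ^ (d + 4))⁻¹) volume := by
  have hc : Continuous fun y : EuclideanSpace ℝ (Fin 3) => ‖y‖ ^ d * ((‖y‖ + a) ^ (d + 4))⁻¹ := by
    refine (continuous_norm.pow d).mul (((continuous_norm.add continuous_const).pow _).inv₀ fun y => ?_)
    show (‖y‖ + a) ^ (d + 4) ≠ 0
    positivity
  refine integrable_of_norm_le_apexWeight hc.aestronglyMeasurable ha (p := 4) le_rfl (C := 1) fun y => ?_
  rw [Real.norm_of_nonneg (by positivity), one_div]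
  exact norm_pow_mul_inv_norm_add_pow_le ha d 4 y

/-! ### Densities with the septic apex bound -/

section Density

variable {F : EuclideanSpace ℝ (Fin 3) → EuclideanSpace ℝ (Fin 3)} {N a : ℝ}

/-- The constant of an apex bound is non-negative. [folklore] -/
theorem nonneg_of_apexBound (ha : 0 < a) {p : ℕ} (hF : ∀ y, ‖F y‖ ≤ N * a ^ 4 / (‖y‖ + a) ^ p) : 0 ≤ N := by
  have h := (norm_nonneg _).trans (hF 0)
  rw [norm_zero, zero_add] at h
  by_contra hN
  have : N * a ^ 4 / a ^ p < 0 := div_neg_of_neg_of_pos (mul_neg_of_neg_of_pos (not_le.1 hN) (by positivity))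
    (by positivity)
  linarith

/-- A density with the septic apex bound is integrable. [folklore] -/
theorem integrable_of_apexBound_seven (hFc : Continuous F) (ha : 0 < a)
    (hF : ∀ y, ‖F y‖ ≤ N * a ^ 4 / (‖y‖ + a) ^ 7) : Integrable F volume :=
  integrable_of_norm_le_apexWeight hFc.aestronglyMeasurable ha (by norm_num) hF

/-- First coordinate moments of a density with the septic apex bound converge absolutely. [folklore] -/
theorem integrable_coord_smul_of_apexBound_seven (hFc : Continuous F) (ha : 0 < a)
    (hF : ∀ y, ‖F y‖ ≤ N * a ^ 4 / (‖y‖ + a) ^ 7) (l : Fin 3) :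
    Integrable (fun y : EuclideanSpace ℝ (Fin 3) => (y l) • F y) volume := by
  have hN := nonneg_of_apexBound ha hF
  refine integrable_of_norm_le_apexWeight (((EuclideanSpace.proj l).continuous).smul hFc).aestronglyMeasurable
    ha (p := 6) (by norm_num) (C := N * a ^ 4) fun y => ?_
  rw [norm_smul]
  calc ‖y l‖ * ‖F y‖ ≤ ‖y‖ * (N * a ^ 4 / (‖y‖ + a) ^ (6 + 1)) :=
        mul_le_mul (PiLp.norm_apply_le y l) (hF y) (norm_nonneg _) (norm_nonneg _)
    _ ≤ N * a ^ 4 / (‖y‖ + a) ^ 6 := norm_mul_div_apexWeight_succ_le ha (by positivity) 6 y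

/-- Second coordinate moments of a density with the septic apex bound converge absolutely. [folklore] -/
theorem integrable_coord_mul_coord_smul_of_apexBound_seven (hFc : Continuous F) (ha : 0 < a)
    (hF : ∀ y, ‖F y‖ ≤ N * a ^ 4 / (‖y‖ + a) ^ 7) (l n : Fin 3) :
    Integrable (fun y : EuclideanSpace ℝ (Fin 3) => (y l * y n) • F y) volume := by
  have hN := nonneg_of_apexBound ha hF
  refine integrable_of_norm_le_apexWeight
    ((((EuclideanSpace.proj l).continuous).mul ((EuclideanSpace.proj n).continuous)).smul hFc).aestronglyMeasurable
    ha (p := 5) (by norm_num) (C := N * a ^ 4) fun y => ?_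
  rw [norm_smul, norm_mul]
  calc ‖y l‖ * ‖y n‖ * ‖F y‖ ≤ ‖y‖ * ‖y‖ * (N * a ^ 4 / (‖y‖ + a) ^ (5 + 1 + 1)) :=
        mul_le_mul (mul_le_mul (PiLp.norm_apply_le y l) (PiLp.norm_apply_le y n) (norm_nonneg _)
          (norm_nonneg _)) (hF y) (norm_nonneg _) (by positivity)
    _ = ‖y‖ * (‖y‖ * (N * a ^ 4 / (‖y‖ + a) ^ (5 + 1 + 1))) := by ring
    _ ≤ ‖y‖ * (N * a ^ 4 / (‖y‖ + a) ^ (5 + 1)) :=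
        mul_le_mul_of_nonneg_left (norm_mul_div_apexWeight_succ_le ha (by positivity) (5 + 1) y) (norm_nonneg _)
    _ ≤ N * a ^ 4 / (‖y‖ + a) ^ 5 := norm_mul_div_apexWeight_succ_le ha (by positivity) 5 y

/-- **The third absolute moment**: `‖y‖³ ‖F(y)‖` is integrable and
`∫ ‖y‖³ ‖F(y)‖ dy ≤ N I a³`, `I = ∫ ‖z‖³/(‖z‖+1)⁷ dz` (scaling `y = a z`). [folklore] -/
theorem integral_norm_cube_mul_norm_le (hFc : Continuous F) (ha : 0 < a)
    (hF : ∀ y, ‖F y‖ ≤ N * a ^ 4 / (‖y‖ + a) ^ 7) :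
    Integrable (fun y : EuclideanSpace ℝ (Fin 3) => ‖y‖ ^ 3 * ‖F y‖) volume ∧
      ∫ y : EuclideanSpace ℝ (Fin 3), ‖y‖ ^ 3 * ‖F y‖ ≤
        N * (∫ z : EuclideanSpace ℝ (Fin 3), ‖z‖ ^ 3 * ((‖z‖ + 1) ^ 7)⁻¹) * a ^ 3 := by
  have hN := nonneg_of_apexBound ha hF
  have hmaj : Integrable (fun y : EuclideanSpace ℝ (Fin 3) => N * a ^ 4 * (‖y‖ ^ 3 * ((‖y‖ + a) ^ (3 + 4))⁻¹))
      volume := (integrable_norm_pow_mul_inv_norm_add_pow ha 3).const_mul _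
  have hle : ∀ y : EuclideanSpace ℝ (Fin 3), ‖y‖ ^ 3 * ‖F y‖ ≤ N * a ^ 4 * (‖y‖ ^ 3 * ((‖y‖ + a) ^ (3 + 4))⁻¹) :=
    fun y => by
    calc ‖y‖ ^ 3 * ‖F y‖ ≤ ‖y‖ ^ 3 * (N * a ^ 4 / (‖y‖ + a) ^ 7) :=
          mul_le_mul_of_nonneg_left (hF y) (by positivity)
      _ = N * a ^ 4 * (‖y‖ ^ 3 * ((‖y‖ + a) ^ (3 + 4))⁻¹) := by ring
  have hint : Integrable (fun y : EuclideanSpace ℝ (Fin 3) => ‖y‖ ^ 3 * ‖F y‖) volume :=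
    hmaj.mono' ((continuous_norm.pow 3).mul hFc.norm).aestronglyMeasurable
      (Eventually.of_forall fun y => by
        rw [Real.norm_of_nonneg (by positivity)]
        exact hle y)
  refine ⟨hint, ?_⟩
  calc ∫ y : EuclideanSpace ℝ (Fin 3), ‖y‖ ^ 3 * ‖F y‖
      ≤ ∫ y : EuclideanSpace ℝ (Fin 3), N * a ^ 4 * (‖y‖ ^ 3 * ((‖y‖ + a) ^ (3 + 4))⁻¹) :=
        integral_mono hint hmaj hle
    _ = N * (∫ z : EuclideanSpace ℝ (Fin 3), ‖z‖ ^ 3 * ((‖z‖ + 1) ^ 7)⁻¹) * a ^ 3 := by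
        rw [integral_const_mul, integral_norm_pow_mul_inv_norm_add_pow ha 3 (3 + 4)]
        have ha' : a ≠ 0 := ha.ne'
        field_simp
        ring

/-- Moments against a continuous form of polynomial growth `|q(y)| ≤ Q ‖y‖ᵈ`, `d ≤ 2`, converge
absolutely. [folklore] -/
theorem integrable_smul_of_growth_of_apexBound_seven (hFc : Continuous F) (ha : 0 < a)
    (hF : ∀ y, ‖F y‖ ≤ N * a ^ 4 / (‖y‖ + a) ^ 7) {q : EuclideanSpace ℝ (Fin 3) → ℝ} (hqc : Continuous q)
    {Q : ℝ} {d : ℕ} (hd : d ≤ 2) (hq : ∀ y, ‖q y‖ ≤ Q * ‖y‖ ^ d) :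
    Integrable (fun y : EuclideanSpace ℝ (Fin 3) => q y • F y) volume := by
  have hN := nonneg_of_apexBound ha hF
  obtain ⟨y₀, hy₀⟩ : ∃ y₀ : EuclideanSpace ℝ (Fin 3), y₀ ≠ 0 := exists_ne 0
  have hQ0 : 0 ≤ Q :=
    nonneg_of_mul_nonneg_left ((norm_nonneg _).trans (hq y₀)) (pow_pos (norm_pos_iff.2 hy₀) d)
  -- majorant: `Q ‖y‖ᵈ · N a⁴/(‖y‖+a)⁷ ≤ Q N a⁴ /(‖y‖+a)^{7-d}` with `7 - d ≥ 5`
  obtain ⟨r, hr⟩ : ∃ r : ℕ, 7 = d + r ∧ 4 ≤ r := ⟨7 - d, by omega, by omega⟩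
  refine integrable_of_norm_le_apexWeight (hqc.smul hFc).aestronglyMeasurable ha (p := r) hr.2
    (C := Q * (N * a ^ 4)) fun y => ?_
  have hρ : 0 < ‖y‖ + a := by positivity
  rw [norm_smul]
  calc ‖q y‖ * ‖F y‖ ≤ Q * ‖y‖ ^ d * (N * a ^ 4 / (‖y‖ + a) ^ 7) :=
        mul_le_mul (hq y) (hF y) (norm_nonneg _) (by positivity)
    _ = Q * (N * a ^ 4) * (‖y‖ ^ d * ((‖y‖ + a) ^ (d + r))⁻¹) := by rw [hr.1]; ring
    _ ≤ Q * (N * a ^ 4) * ((‖y‖ + a) ^ r)⁻¹ :=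
        mul_le_mul_of_nonneg_left (norm_pow_mul_inv_norm_add_pow_le ha d r y) (by positivity)
    _ = Q * (N * a ^ 4) / (‖y‖ + a) ^ r := by rw [div_eq_mul_inv]

/-! ### Vanishing moments against multilinear forms -/

/-- Expansion of a continuous multilinear form on the diagonal in the standard basis of `ℝ³`:
`M(y, …, y) = Σ_r (∏ᵢ y_{r i}) M(e_{r 0}, …, e_{r (n-1)})`. [folklore] -/
theorem multilinear_diag_eq_sum {n : ℕ} (M : ContinuousMultilinearMap ℝ (fun _ : Fin n => EuclideanSpace ℝ (Fin 3)) ℝ)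
    (y : EuclideanSpace ℝ (Fin 3)) :
    M (fun _ => y) = ∑ r : Fin n → Fin 3,
      (∏ i, y (r i)) * M (fun i => EuclideanSpace.single (r i) (1 : ℝ)) := by
  classical
  have hy : (fun _ : Fin n => y) =
      fun _ : Fin n => ∑ j : Fin 3, (y j) • (EuclideanSpace.single j (1 : ℝ) : EuclideanSpace ℝ (Fin 3)) := by
    funext i
    conv_lhs => rw [← (EuclideanSpace.basisFun (Fin 3) ℝ).sum_repr y]
    simp only [EuclideanSpace.basisFun_repr, EuclideanSpace.basisFun_apply]
  rw [hy, M.map_sum (fun (_ : Fin n) (j : Fin 3) => (y j) • (EuclideanSpace.single j (1 : ℝ) : EuclideanSpace ℝ (Fin 3)))]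
  refine Finset.sum_congr rfl fun r _ => ?_
  rw [M.map_smul_univ (fun i => y (r i)) (fun i => EuclideanSpace.single (r i) (1 : ℝ)), smul_eq_mul]

/-- **First moments against linear forms vanish** when the coordinate first moments do:
`∫ M(y) • F(y) dy = 0` for every continuous `1`-multilinear form `M`. [folklore] -/
theorem integral_multilinear_one_smul_eq_zero
    (h1i : ∀ l : Fin 3, Integrable (fun y : EuclideanSpace ℝ (Fin 3) => (y l) • F y) volume)
    (h1 : ∀ l : Fin 3, ∫ y : EuclideanSpace ℝ (Fin 3), (y l) • F y = 0)
    (M : ContinuousMultilinearMap ℝ (fun _ : Fin 1 => EuclideanSpace ℝ (Fin 3)) ℝ) :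
    ∫ y : EuclideanSpace ℝ (Fin 3), (M fun _ => y) • F y = 0 := by
  have e : ∀ y : EuclideanSpace ℝ (Fin 3), (M fun _ => y) • F y =
      ∑ r : Fin 1 → Fin 3, (M fun i => EuclideanSpace.single (r i) (1 : ℝ)) • ((y (r 0)) • F y) := by
    intro y
    rw [multilinear_diag_eq_sum M y, Finset.sum_smul]
    refine Finset.sum_congr rfl fun r _ => ?_
    rw [Fin.prod_univ_one, smul_smul, mul_comm]
  simp_rw [e]
  rw [integral_finsetSum _ fun r _ => (h1i (r 0)).smul (M fun i => EuclideanSpace.single (r i) (1 : ℝ))]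
  refine Finset.sum_eq_zero fun r _ => ?_
  rw [integral_smul, h1 (r 0), smul_zero]

/-- **Second moments against bilinear forms vanish** when the coordinate second moments do:
`∫ M(y, y) • F(y) dy = 0` for every continuous `2`-multilinear form `M`. [folklore] -/
theorem integral_multilinear_two_smul_eq_zero
    (h2i : ∀ l n : Fin 3, Integrable (fun y : EuclideanSpace ℝ (Fin 3) => (y l * y n) • F y) volume)
    (h2 : ∀ l n : Fin 3, ∫ y : EuclideanSpace ℝ (Fin 3), (y l * y n) • F y = 0)
    (M : ContinuousMultilinearMap ℝ (fun _ : Fin 2 => EuclideanSpace ℝ (Fin 3)) ℝ) :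
    ∫ y : EuclideanSpace ℝ (Fin 3), (M fun _ => y) • F y = 0 := by
  have e : ∀ y : EuclideanSpace ℝ (Fin 3), (M fun _ => y) • F y =
      ∑ r : Fin 2 → Fin 3, (M fun i => EuclideanSpace.single (r i) (1 : ℝ)) • ((y (r 0) * y (r 1)) • F y) := by
    intro y
    rw [multilinear_diag_eq_sum M y, Finset.sum_smul]
    refine Finset.sum_congr rfl fun r _ => ?_
    rw [Fin.prod_univ_two, smul_smul, mul_comm]
  simp_rw [e]
  rw [integral_finsetSum _ fun r _ => (h2i (r 0) (r 1)).smul (M fun i => EuclideanSpace.single (r i) (1 : ℝ))]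
  refine Finset.sum_eq_zero fun r _ => ?_
  rw [integral_smul, h2 (r 0) (r 1), smul_zero]

end Density

/-! ### Registered sub-goal -/

/-- **Registered helper stub `stub_biotSavartMomentsTools`** of `stub_biotSavartFarField` (crux
stmt-NavierStokesRegularity-11717, line `moment-conditioned-rellich`): the weight tools of this file — scaling of
the apex-weight integrals, the third absolute moment of a septically flat density, and the vanishing of second
moments against bilinear forms. [folklore] -/
theorem stub_biotSavartMomentsTools :
    (∀ (a : ℝ), 0 < a → ∀ (d p : ℕ),
      ∫ y : EuclideanSpace ℝ (Fin 3), ‖y‖ ^ d * ((‖y‖ + a) ^ p)⁻¹ =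
        a ^ (3 + d) / a ^ p * ∫ y : EuclideanSpace ℝ (Fin 3), ‖y‖ ^ d * ((‖y‖ + 1) ^ p)⁻¹) ∧
    (∀ (F : EuclideanSpace ℝ (Fin 3) → EuclideanSpace ℝ (Fin 3)) (N a : ℝ), Continuous F → 0 < a →
      (∀ y, ‖F y‖ ≤ N * a ^ 4 / (‖y‖ + a) ^ 7) →
      Integrable (fun y : EuclideanSpace ℝ (Fin 3) => ‖y‖ ^ 3 * ‖F y‖) volume ∧
        ∫ y : EuclideanSpace ℝ (Fin 3), ‖y‖ ^ 3 * ‖F y‖ ≤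
          N * (∫ z : EuclideanSpace ℝ (Fin 3), ‖z‖ ^ 3 * ((‖z‖ + 1) ^ 7)⁻¹) * a ^ 3) ∧
    (∀ (F : EuclideanSpace ℝ (Fin 3) → EuclideanSpace ℝ (Fin 3)),
      (∀ l n : Fin 3, Integrable (fun y : EuclideanSpace ℝ (Fin 3) => (y l * y n) • F y) volume) →
      (∀ l n : Fin 3, ∫ y : EuclideanSpace ℝ (Fin 3), (y l * y n) • F y = 0) →
      ∀ M : ContinuousMultilinearMap ℝ (fun _ : Fin 2 => EuclideanSpace ℝ (Fin 3)) ℝ,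
        ∫ y : EuclideanSpace ℝ (Fin 3), (M fun _ => y) • F y = 0) :=
  ⟨fun _a ha d p => integral_norm_pow_mul_inv_norm_add_pow ha d p,
    fun _F _N _a hFc ha hF => integral_norm_cube_mul_norm_le hFc ha hF,
    fun _F h2i h2 M => integral_multilinear_two_smul_eq_zero h2i h2 M⟩

end Summit.NavierStokesRegularity.NavierStokesRegularity.Theorems.RellichScarScarRigidity

end
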